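import Literature.MathematicalPhysics.QuantumFieldTheory.Balaban1983to89.B8Eq142KLevelLocalRec
import Literature.MathematicalPhysics.QuantumFieldTheory.Balaban1983to89.B8Eq142KLevelLocalGamma

/-!
# `Balaban1983to89.B8Eq142KLevelLocalGammaRec` — RECORD TWIN of `B8Eq142KLevelLocalGamma.H42_of_inAx_γ` ([Balaban1985RegularSpaces] Theorem 4's auxiliary condition
# (1.42) «|Q_j(U₀, ηA)| < 2dLα₁» AT `k` LEVELS for the gauge-fixed fields of Theorem 4's induction, on a general constraint-bond family, edition γ — print's box law
# «box ⊂ Ω_{j−1}») FOR THE SYMMETRISED CENTRED block averaging (0.4) of [Balaban1987RG1], record Prop-4 regime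

statement-level skeleton of published theorems with citation tags; proofs where landed; nothing here is a claim about the Yang–Mills mass gap

T. Bałaban, *Spaces of regular gauge field configurations on a lattice and gauge fixing conditions*, Commun. Math. Phys. **99** (1985) 75–102 `[Balaban1985RegularSpaces]`
("[6]"): (1.42) p. 83, (1.37) + (1.30)–(1.31) p. 82, (1.35) p. 82, (1.29) p. 81, (1.19) p. 79, Thm 4 p. 88, p. 77 (bonds «with at least one end-point in Ω_j»); T. Bałaban,
*Averaging operations for lattice gauge theories*, Commun. Math. Phys. **98** (1985) 17–51 `[Balaban1985Averaging]` ("[3]"): p. 24, (87) p. 31, (127) p. 37; T. Bałaban,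
*Renormalization group approach to lattice gauge field theories. I*, Commun. Math. Phys. **109** (1987) 249–301 `[Balaban1987RG1]` ("[I]"): (0.3)–(0.4) pp. 252–253.

CITATION HEADER (lean-in-tree rule).  Cell `pub-ymgap`, «N05-REC» stage 2 (director-ym №254∕№255∕№265∕№267∕№288), item R5 sub-chain β, head 4 — typed by the LEAD PEN
dag-n05-e g38 on dag-n05-c's recipe (inventory `N05-REC-INVENTORY.md` §R5 row `B8Eq142KLevelLocalGamma`: class A = `H42_of_inAx_γ`).  WHAT IS REPRODUCED = ✓ the engine
theorem over `B8Eq142KLevelLocalRec` (the three tower-local record (1.42) lemmas), dag-n05-d's `B8Eq131DerivationRec.eq87_of_inAxZ_restr129Z` and `B8Eq119TwistedAxialRec.{InAxZ,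
Restr129Z}`, dag-n05-e's `B7Prop2Rec.avgClosedZ_unitaryUnits`, and the class-0 letters `InAk`, `mulCfg`, `cfgExp`, `SideTouches` (T6).  TOKEN MAP: `logCovIter ∕ avgIter ∕ wrec ∕ InAx ∕
Restr129 ↦ logCovIterZ ∕ avgIterZ ∕ wrecZ ∕ InAxZ ∕ Restr129Z`; the corner box `[loK, bondHiK]` of a datum bond and the corner block `[L•c₋, L•c₋ + blockTop L]` ↦ the CENTRED box
`[Lʲc₋ − c_j𝟙, Lʲc₋ + Lʲe_κ + c_j𝟙]` and block `[L•c₋ − s𝟙, L•c₋ + s𝟙]` ([I] (0.3)); the engine's Prop-4 windows ONE LEVEL LOWER ↦ the record's at `(L²α₀, Lα₂)`: odd `L = 2s+1`,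
`1 ≤ s`, `C0Z·(L²α₀) ≤ 1∕3`, `4L²α₀ ≤ c₂′`, `e^{4cZ·L²α₀}(1 + 2C₁KZ²·Lα₂) ≤ 2`, `KZ·Lα₂ ≤ c₃` (the engine's idle `h16 : 16Lα₂ ≤ 1` is dropped).  Declaration name = engine name
(T5); proof = the engine's lines over the record inputs.  Kind «kernel-checked proof», theorems only; no `def`, no `instance`, no `notation`, no existing module modified.
`--supports stmt-QuantumFields-20541` (K0⁷-keyed, COUNT-NEUTRAL).

HONEST SCOPE: the (1.42) socket `H42` of Theorem 4's record driver as a theorem for classified constraint-bond families; nothing of Bałaban's analysis re-proved;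
`HThm4Rec` UNDISCHARGED; caveat (C-S3-1) + addendum v4 stand; N05 [B8] DISCHARGED OF RECORD untouched; COUNT of record unmoved · K numerically unchanged; one finite `𝕋⁴`
programme at fixed `ε`, Bałaban AS PRINTED; nothing continuum ∕ ℝ⁴ ∕ OS ∕ mass-gap ∕ Clay.  No `sorry`, no `def`.

[cite: Balaban1985RegularSpaces, (1.42) p.83, (1.37) p.82, (1.35) p.82, (1.29) p.81, (1.19) p.79, Thm 4 p.88; Balaban1985Averaging, p.24, (87) p.31, (127) p.37; Balaban1987RG1, (0.3)–(0.4) pp.252–253]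
-/

noncomputable section

open NormedSpace

namespace Literature.MathematicalPhysics.QuantumFieldTheory.Balaban1983to89.B8Eq142KLevelLocalGammaRec

open Complex (I)
open MatrixLog B7Prop1Explicit B7Prop2Explicit B7Prop1Local B7AvgGaugeCovariance
open B7Eq92Concrete (mgauge mgauge_apply)
open B7Prop3Flat (expCfg c3)
open B7Prop5Flat (BondIn)
open B7Prop2Rec (AvgClosedZ C0Z avgClosedZ_unitaryUnits)
open B7Prop4GeneralLevelsRec (cZ KZ)
open BlockAveragingZd (avgIterZ avgIterZ_zero ctrShift)
open B7SectCDGaugeAveragesRec (wrecZ wrecZ_zero)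
open B7SectEFLinearisationRec (logCovIterZ)
open B8Ineq132 (InAk pdevOn_lt_of_forall)
open B8Lemma1NonAbelian (mulCfg)
open B8Lemma1NonAbelianRecLoops (halfVec)
open B8Eq146AExpansion (iEta)
open B8Eq184Proof (cfgExp)
open B8Eq140Level (SideTouches sideTouches_of_bondTouches)
open B8Eq119TwistedAxialRec (InAxZ Restr129Z)
open B8Eq131DerivationRec (eq87_of_inAxZ_restr129Z)
open B8Eq137QjEqBRec (norm_Qj_lt_interior_zero)
open B8Eq142KLevelLocalRec (norm_Qj_lt_interior_loc norm_Qj_lt_crossing_loc norm_Qj_lt_crossing_mirrored_loc inBox_box_of_blockBond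
  inBox_box_of_blockBond_snd)

-- `Site` alone could resolve to the torus sites of `Setup.lean`; re-export the `ℤ^d` sites of `B7Prop1Explicit`.
export B7Prop1Explicit (Site)

variable {d : ℕ}

variable {𝔸 : Type*} [CStarAlgebra 𝔸] [Nontrivial 𝔸]

/-- Two distinct lattice directions exist when `d ≥ 2` (private plumbing, as in the engine). [folklore] -/
private theorem exists_ne_dir' (hd2 : 2 ≤ d) (μ : Fin d) : ∃ κ : Fin d, κ ≠ μ := by
  by_cases h : (μ : ℕ) = 0
  · exact ⟨⟨1, by omega⟩, fun e => by have := congrArg Fin.val e; simp [h] at this⟩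
  · exact ⟨⟨0, by omega⟩, fun e => by have := congrArg Fin.val e; simp at this; omega⟩

omit [Nontrivial 𝔸] in
/-- The two exponent-field spellings agree bondwise (`B8Prop3GaugeFixedKLevel.expCfg_iEta_eq_cfgExp`; private plumbing). [folklore] -/
private theorem expCfg_iEta_apply (η : ℝ) (A : Site d → Fin d → 𝔸) (x : Site d) (κ : Fin d) :
    expCfg (iEta η A) x κ = cfgExp η A x κ :=
  congrFun (congrFun (B8Prop3GaugeFixedKLevel.expCfg_iEta_eq_cfgExp η A) x) κ

/-- ★ (RECORD TWIN of `B8Eq142KLevelLocalGamma.H42_of_inAx_γ`.) **THE (1.42) CLAUSE AT `k` LEVELS FOR GAUGE-FIXED FIELDS ON A GENERAL CONSTRAINT-BOND FAMILY, EDITION γ,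
RECORD AVERAGING — PRINT's BOX LAW «box ⊂ Ω_{j−1}», CENTRED BOXES.**  For a family `Λb m j` whose bonds are interior, crossing or mirrored-crossing (`hclass`, the crossing
bonds' CENTRED `L`-blocks `[L•c∓ − s𝟙, L•c∓ + s𝟙]` made of level-`(j−1)` constraint sites), with the CENTRED locality box `[Lʲc₋ − c_j𝟙, Lʲc₋ + Lʲe_κ + c_j𝟙]` of every level-`j`
datum bond inside `Ω_{j−1}` (`hbox`; level 0 reads `Ω₀`) and (1.35) available for the RECORD averages on every level-`j` bond whose box lies in `Ω_{j−1}` (`h135`): for every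
gauge-fixed `W = U′^{u⁻¹} = e^{iηA′}` of Theorem 4's induction ((1.29) `Restr129Z`, (1.19) `InAxZ` on the constraint sites) and every datum bond `c`, `‖Q_j(U₀, iηA′)(c)‖ < 2dLα₁`
(record composite `logCovIterZ`).  The reads of (1.33)∕(1.34) and (1.41) on the box happen at level `j−1`, whence the record windows at `(L²α₀, Lα₂)`.  Proof = the engine's,
engines by name over the record lemmas (odd `L = 2s+1 ≥ 3`, `d ≥ 2`).
[cite: Balaban1985RegularSpaces, (1.42) p.83, (1.37) + (1.30)–(1.31) p.82, (1.35) p.82, (1.29) p.81, (1.19) p.79, Thm 4 p.88, p.77; Balaban1987RG1, (0.3)–(0.4) pp.252–253] -/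
theorem H42_of_inAx_γ (hd2 : 2 ≤ d) {η : ℝ} (hη : 0 < η) {L s : ℕ} (hLs : L = 2 * s + 1) (hs : 1 ≤ s) (k : ℕ)
    {U₀ U' : Site d → Fin d → 𝔸ˣ} (hU₀ : ∀ x κ, U₀ x κ ∈ unitaryUnits 𝔸)
    {α₀ α₁ α₂ : ℝ} (hα₀ : 0 < α₀) (hα₁ : 0 < α₁) (hα₂ : 0 ≤ α₂)
    -- the record's Prop-4 windows ONE LEVEL LOWER: at `(L²α₀, Lα₂)` (the box of a datum bond of level `j` lies in `Ω_{j−1}` only)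
    (hα3 : C0Z d * ((L : ℝ) ^ 2 * α₀) ≤ 1 / 3) (hα4 : 4 * ((L : ℝ) ^ 2 * α₀) ≤ c2' d L)
    (hsmall : Real.exp (4 * cZ d * ((L : ℝ) ^ 2 * α₀)) * (1 + 2 * (131072 * ((d : ℝ) + 1) ^ 2) * (KZ d L) ^ 2 * ((L : ℝ) * α₂)) ≤ 2)
    (hc₃ : KZ d L * ((L : ℝ) * α₂) ≤ c3 d L) (hsmall₁ : (d : ℝ) * L * α₁ ≤ 1 / 8)
    (Ω : ℕ → Set (Site d)) (hΩ : ∀ j, Ω (j + 1) ⊆ Ω j) (Λs : ℕ → ℕ → Set (Site d)) (Λb : ℕ → ℕ → Set (Site d × Fin d))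
    -- PRINT's box law, CENTRED boxes: the locality box of a datum bond of level `j` lies in `Ω_{j−1}` (level 0: `Ω₀`)
    (hbox : ∀ m, m ≤ k → ∀ j, j ≤ m → ∀ c ∈ Λb m j, ∀ x,
      InBox (fun i => (L : ℤ) ^ j * c.1 i - (ctrShift L j : ℤ)) (fun i => (L : ℤ) ^ j * c.1 i + (ctrShift L j : ℤ) + if i = c.2 then (L : ℤ) ^ j else 0) x →
      x ∈ Ω (j - 1))
    (hclass : ∀ m, m ≤ k → ∀ j, j ≤ m → ∀ c ∈ Λb m j,
      (c.1 ∈ Λs m j ∧ c.1 + e c.2 ∈ Λs m j) ∨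
      (∃ j', j = j' + 1 ∧ (∀ x, (L : ℤ) • c.1 - halfVec L ≤ x → x ≤ (L : ℤ) • c.1 + halfVec L → x ∈ Λs m j') ∧ c.1 + e c.2 ∈ Λs m j) ∨
      (∃ j', j = j' + 1 ∧ c.1 ∈ Λs m j ∧ (∀ x, (L : ℤ) • (c.1 + e c.2) - halfVec L ≤ x → x ≤ (L : ℤ) • (c.1 + e c.2) + halfVec L → x ∈ Λs m j')))
    (h33 : InAk L k η α₀ Ω U₀) (h34 : InAk L k η α₀ Ω (mulCfg U' U₀)) (hAx : ∀ m, m ≤ k → InAxZ L m (Λs m) U₀ (mulCfg U' U₀))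
    -- (1.35) for the RECORD averages on every level-`j` bond whose CENTRED locality box lies in `Ω_{j−1}`
    (h135 : ∀ j, j ≤ k → ∀ (z : Site d) (μ : Fin d),
      (∀ x, InBox (fun i => (L : ℤ) ^ j * z i - (ctrShift L j : ℤ)) (fun i => (L : ℤ) ^ j * z i + (ctrShift L j : ℤ) + if i = μ then (L : ℤ) ^ j else 0) x →
        x ∈ Ω (j - 1)) →
      ‖(avgIterZ L (mulCfg U' U₀) j z μ : 𝔸) - (avgIterZ L U₀ j z μ : 𝔸)‖ ≤ α₁)
    (Lan : ℕ → (Site d → Fin d → 𝔸ˣ) → Prop) :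
    ∀ m, 1 ≤ m → m ≤ k → ∀ (u : Site d → 𝔸ˣ) (W : Site d → Fin d → 𝔸ˣ) (A' : Site d → Fin d → 𝔸),
      (∀ x, u x ∈ unitaryUnits 𝔸) → mgauge U₀ u W = U' → Restr129Z L m (Λs m) U₀ u → Lan m W →
      (∀ y τ, IsSelfAdjoint (A' y τ)) →
      (∀ j, j ≤ m → ∀ y τ, SideTouches (Ω j) y τ →
        W y τ = cfgExp η A' y τ ∧ ‖A' y τ‖ ≤ α₂ * ((L : ℝ) ^ j * η)⁻¹) →
      (∀ y τ, (∀ j, j ≤ m → ¬ SideTouches (Ω j) y τ) → A' y τ = 0) →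
      ∀ j, j ≤ m → ∀ c ∈ Λb m j, ‖logCovIterZ L U₀ (iEta η A') j c.1 c.2‖ < 2 * d * L * α₁ := by
  intro m hm1 hmk u W A' hu hW h129 hLan hsa hWA hA0 j hj c hc
  have hL1 : 1 ≤ L := by omega
  have hd1 : 1 ≤ d := le_trans (by norm_num) hd2
  have hLr : (1 : ℝ) ≤ L := by exact_mod_cast hL1
  -- `Ω_{j'+1} ⊆ Ω_{j'} ⊆ Ω_{j'−1}`: the target of the γ box law one level down
  have hΩp : ∀ i, Ω (i + 1 - 1) ⊆ Ω (i - 1) := by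
    intro i x hx
    rw [Nat.add_sub_cancel] at hx
    rcases Nat.eq_zero_or_pos i with rfl | hip
    · simpa using hx
    · obtain ⟨i', rfl⟩ : ∃ i', i = i' + 1 := ⟨i - 1, by omega⟩
      rw [Nat.add_sub_cancel]; exact hΩ i' hx
  have hG : AvgClosedZ d L (unitaryUnits 𝔸) := avgClosedZ_unitaryUnits d L
  have hu1 : ∀ x, u x ∈ U1 𝔸 := fun x => unitaryUnits_le_U1 (hu x)
  -- the field `WU₀` is `U′U₀`; its class `𝔄` by gauge invariance
  have hWU : mgauge U₀ u W * U₀ = mulCfg U' U₀ := by rw [hW]; rfl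
  have h34W : InAk L m η α₀ Ω (mulCfg W U₀) := by
    have h1 : InAk L m η α₀ Ω (mulCfg U' U₀) := fun j hj => h34 j (hj.trans hmk)
    have hui : ∀ x, u⁻¹ x ∈ U1 𝔸 := fun x => unitaryUnits_le_U1 ((unitaryUnits 𝔸).inv_mem (hu x))
    rw [B8Prop3GaugeFixedKLevel.mulCfg_eq_gaugeAct_of_mgauge_eq hW]
    exact (B8Ineq132.inAk_gaugeAct_iff L m η α₀ Ω hui _).2 h1
  -- (87) at all constraint sites, from (1.19)/(1.29) in the record letters
  have h87 := eq87_of_inAxZ_restr129Z hLs m (Λs m) U₀ W u (by rw [hWU]; exact hAx m hmk) h129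
  -- `e^{iηA′}` is unitary-valued
  have hBG : ∀ x μ, expCfg (iEta η A') x μ ∈ unitaryUnits 𝔸 := fun x μ => B8Eq155JBound.expCfg_iEta_mem_unitaryUnits η hsa x μ
  -- reading one level lower: the scale factors
  have hLpos : (0 : ℝ) < L := by exact_mod_cast (show 0 < L by omega)
  have hjm1 : j - 1 ≤ m := (Nat.sub_le j 1).trans hj
  have hpow1 : ((L : ℝ) ^ (j - 1))⁻¹ ≤ (L : ℝ) * ((L : ℝ) ^ j)⁻¹ := by
    rcases Nat.eq_zero_or_pos j with rfl | hjp
    · simp only [Nat.zero_sub, pow_zero, inv_one, mul_one]; exact hLr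
    · obtain ⟨i, rfl⟩ : ∃ i, j = i + 1 := ⟨j - 1, by omega⟩
      rw [Nat.add_sub_cancel, pow_succ, mul_inv, ← mul_assoc, mul_comm (L : ℝ), mul_assoc, mul_inv_cancel₀ hLpos.ne', mul_one]
  have hpow2 : (((L : ℝ) ^ (j - 1))⁻¹) ^ 2 ≤ (L : ℝ) ^ 2 * (((L : ℝ) ^ j)⁻¹) ^ 2 := by
    have h := mul_self_le_mul_self (by positivity) hpow1
    nlinarith [h]
  have hboxbond : ∀ x μ, BondIn (fun i => (L : ℤ) ^ j * c.1 i - (ctrShift L j : ℤ))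
      (fun i => (L : ℤ) ^ j * c.1 i + (ctrShift L j : ℤ) + if i = c.2 then (L : ℤ) ^ j else 0) x μ →
      W x μ = cfgExp η A' x μ ∧ ‖iEta η A' x μ‖ ≤ ((L : ℝ) * α₂) * ((L : ℝ) ^ j)⁻¹ := by
    intro x μ hb
    obtain ⟨ν, hν⟩ := exists_ne_dir' hd2 μ
    have hs : SideTouches (Ω (j - 1)) x μ := sideTouches_of_bondTouches hν (Or.inl (hbox m hmk j hj c hc x hb.1))
    obtain ⟨hWx, hAx'⟩ := hWA (j - 1) hjm1 x μ hs
    refine ⟨hWx, ?_⟩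
    show ‖((I : ℂ) * η) • A' x μ‖ ≤ ((L : ℝ) * α₂) * ((L : ℝ) ^ j)⁻¹
    rw [norm_smul, norm_mul, Complex.norm_I, one_mul, Complex.norm_real, Real.norm_eq_abs, abs_of_pos hη]
    calc η * ‖A' x μ‖ ≤ η * (α₂ * ((L : ℝ) ^ (j - 1) * η)⁻¹) := mul_le_mul_of_nonneg_left hAx' hη.le
      _ = α₂ * ((L : ℝ) ^ (j - 1))⁻¹ := by field_simp
      _ ≤ α₂ * ((L : ℝ) * ((L : ℝ) ^ j)⁻¹) := mul_le_mul_of_nonneg_left hpow1 hα₂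
      _ = ((L : ℝ) * α₂) * ((L : ℝ) ^ j)⁻¹ := by ring
  have hag : AgreeOn (fun i => (L : ℤ) ^ j * c.1 i - (ctrShift L j : ℤ))
      (fun i => (L : ℤ) ^ j * c.1 i + (ctrShift L j : ℤ) + if i = c.2 then (L : ℤ) ^ j else 0) W (expCfg (iEta η A')) := fun x μ hx hxe => by
    rw [(hboxbond x μ ⟨hx, hxe⟩).1, expCfg_iEta_apply]
  have hα₀' : 0 < (L : ℝ) ^ 2 * α₀ := by positivity
  have hscale : α₀ * (((L : ℝ) ^ (j - 1))⁻¹) ^ 2 ≤ (L : ℝ) ^ 2 * α₀ * (((L : ℝ) ^ j)⁻¹) ^ 2 := by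
    have := mul_le_mul_of_nonneg_left hpow2 hα₀.le
    linarith [this]
  have h40 : ∀ (x : Site d) (μ ν : Fin d), μ ≠ ν →
      PlaqIn (fun i => (L : ℤ) ^ j * c.1 i - (ctrShift L j : ℤ)) (fun i => (L : ℤ) ^ j * c.1 i + (ctrShift L j : ℤ) + if i = c.2 then (L : ℤ) ^ j else 0) (x, μ, ν) →
      ‖((hol U₀ x (plaqWord μ ν) : 𝔸ˣ) : 𝔸) - 1‖ < (L : ℝ) ^ 2 * α₀ * (((L : ℝ) ^ j)⁻¹) ^ 2 :=
    fun x μ ν hμν hp => ((h33 (j - 1) (hjm1.trans hmk)).1 x μ ν hμν (Or.inl (hbox m hmk j hj c hc x hp.1))).trans_le hscale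
  have h40' : ∀ (x : Site d) (μ ν : Fin d), μ ≠ ν →
      PlaqIn (fun i => (L : ℤ) ^ j * c.1 i - (ctrShift L j : ℤ)) (fun i => (L : ℤ) ^ j * c.1 i + (ctrShift L j : ℤ) + if i = c.2 then (L : ℤ) ^ j else 0) (x, μ, ν) →
      ‖((hol (W * U₀) x (plaqWord μ ν) : 𝔸ˣ) : 𝔸) - 1‖ < (L : ℝ) ^ 2 * α₀ * (((L : ℝ) ^ j)⁻¹) ^ 2 :=
    fun x μ ν hμν hp => ((h34W (j - 1) hjm1).1 x μ ν hμν (Or.inl (hbox m hmk j hj c hc x hp.1))).trans_le hscale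
  -- (1.35) at `c`
  have h135c : ‖(avgIterZ L (mgauge U₀ u W * U₀) j c.1 c.2 : 𝔸) - (avgIterZ L U₀ j c.1 c.2 : 𝔸)‖ ≤ α₁ := by
    rw [hWU]; exact h135 j (hj.trans hmk) c.1 c.2 (hbox m hmk j hj c hc)
  rcases hclass m hmk j hj c hc with ⟨hy, hyκ⟩ | ⟨j', rfl, hblk, hyκ⟩ | ⟨j', rfl, hy, hblk⟩
  · -- INTERIOR bond
    rcases j with _ | j
    · -- level 0
      have hc0 : ctrShift L 0 = 0 := by simp [ctrShift]
      have hb0 : BondIn (fun i => (L : ℤ) ^ 0 * c.1 i - (ctrShift L 0 : ℤ))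
          (fun i => (L : ℤ) ^ 0 * c.1 i + (ctrShift L 0 : ℤ) + if i = c.2 then (L : ℤ) ^ 0 else 0) c.1 c.2 := by
        refine ⟨fun i => ?_, fun i => ?_⟩
        · simp only [hc0, pow_zero, one_mul, Nat.cast_zero]; split_ifs <;> omega
        · simp only [hc0, pow_zero, one_mul, Nat.cast_zero, add_e_apply]; split_ifs <;> omega
      obtain ⟨hWc, hAc⟩ := hboxbond c.1 c.2 hb0
      have hlog2 : ‖iEta η A' c.1 c.2‖ < Real.log 2 := by
        rw [pow_zero, inv_one, mul_one] at hAc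
        have hc₃' : KZ d L * ((L : ℝ) ^ 0 * ((L : ℝ) * α₂)) ≤ c3 d L := by rwa [pow_zero, one_mul]
        exact B8Eq137QjEqBRec.lt_log_two_of_regimeZ (B₀ := fun (_ : Site d) (_ : Fin d) => iEta η A' c.1 c.2) hL1 hc₃'
          (fun _ _ => hAc) c.1 c.2
      have hm0 : uLev L u 0 c.1 = (wrecZ L U₀ (expCfg (iEta η A')) 0 c.1)⁻¹ := by
        rw [h87 0 (Nat.zero_le _) c.1 hy, wrecZ_zero, wrecZ_zero]
      have hp0 : uLev L u 0 (c.1 + e c.2) = (wrecZ L U₀ (expCfg (iEta η A')) 0 (c.1 + e c.2))⁻¹ := by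
        rw [h87 0 (Nat.zero_le _) (c.1 + e c.2) hyκ, wrecZ_zero, wrecZ_zero]
      have h₀ : avgIterZ L U₀ 0 c.1 c.2 ∈ U1 𝔸 := by rw [avgIterZ_zero]; exact unitaryUnits_le_U1 (hU₀ _ _)
      have h135' : ‖(avgIterZ L (mgauge U₀ u (expCfg (iEta η A')) * U₀) 0 c.1 c.2 : 𝔸) - (avgIterZ L U₀ 0 c.1 c.2 : 𝔸)‖ ≤ α₁ := by
        have hpt : (mgauge U₀ u (expCfg (iEta η A')) * U₀) c.1 c.2 = (mgauge U₀ u W * U₀) c.1 c.2 := by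
          show mgauge U₀ u (expCfg (iEta η A')) c.1 c.2 * U₀ c.1 c.2 = mgauge U₀ u W c.1 c.2 * U₀ c.1 c.2
          rw [mgauge_apply, mgauge_apply, expCfg_iEta_apply, ← hWc]
        have h := h135c
        rw [avgIterZ_zero, avgIterZ_zero] at h ⊢
        rw [hpt]
        exact h
      exact norm_Qj_lt_interior_zero L hd1 hL1 U₀ (iEta η A') u c.1 c.2 hlog2 hm0 hp0 h₀ hα₁ hsmall₁ h135'
    · -- level `j + 1`
      have hLb : (L : ℝ) ^ (j + 1) * (((L : ℝ) * α₂) * ((L : ℝ) ^ (j + 1))⁻¹) = (L : ℝ) * α₂ := by field_simp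
      exact norm_Qj_lt_interior_loc hLs hs hd1 hG j U₀ c.1 c.2 hU₀ hα₀' hα3 hα4 h40 (iEta η A') (by positivity)
        (fun x μ hbd => (hboxbond x μ hbd).2) (by rw [hLb]; exact hsmall) (by rw [hLb]; exact hc₃) u W hag
        (h87 (j + 1) hj c.1 hy) (h87 (j + 1) hj (c.1 + e c.2) hyκ) hα₁ hsmall₁ h135c
  · -- CROSSING bond at level `j' + 1`: the centred block `B(c₋)` consists of level-`j'` constraint sites
    have hLb : (L : ℝ) ^ (j' + 1) * (((L : ℝ) * α₂) * ((L : ℝ) ^ (j' + 1))⁻¹) = (L : ℝ) * α₂ := by field_simp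
    refine norm_Qj_lt_crossing_loc hLs hs hd1 hG j' U₀ c.1 c.2 hU₀ hα₀' hα3 hα4 h40 (iEta η A') hBG (by positivity)
      (fun x μ hbd => (hboxbond x μ hbd).2) (by rw [hLb]; exact hsmall) (by rw [hLb]; exact hc₃) u hu1 W hag h40'
      (fun x hx1 hx2 => h87 j' (by omega) x (hblk x hx1 hx2)) (h87 (j' + 1) hj (c.1 + e c.2) hyκ) hα₁ hsmall₁
      (fun z μ hz1 hz2 => ?_) h135c
    rw [hWU]
    refine h135 j' (by omega) z μ fun x hx => hΩp j' (hbox m hmk (j' + 1) hj c hc x ?_)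
    exact inBox_box_of_blockBond hLs j' c.1 c.2 hz1 hz2 hx
  · -- MIRRORED crossing bond at level `j' + 1`: the centred block `B(c₊)` consists of level-`j'` constraint sites
    have hLb : (L : ℝ) ^ (j' + 1) * (((L : ℝ) * α₂) * ((L : ℝ) ^ (j' + 1))⁻¹) = (L : ℝ) * α₂ := by field_simp
    refine norm_Qj_lt_crossing_mirrored_loc hLs hs hd1 hG j' U₀ c.1 c.2 hU₀ hα₀' hα3 hα4 h40 (iEta η A') hBG (by positivity)
      (fun x μ hbd => (hboxbond x μ hbd).2) (by rw [hLb]; exact hsmall) (by rw [hLb]; exact hc₃) u hu1 W hag h40'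
      (h87 (j' + 1) hj c.1 hy) (fun x hx1 hx2 => h87 j' (by omega) x (hblk x hx1 hx2)) hα₁ hsmall₁
      (fun z μ hz1 hz2 => ?_) h135c
    rw [hWU]
    refine h135 j' (by omega) z μ fun x hx => hΩp j' (hbox m hmk (j' + 1) hj c hc x ?_)
    exact inBox_box_of_blockBond_snd hLs j' c.1 c.2 hz1 hz2 hx

#print axioms H42_of_inAx_γ

end Literature.MathematicalPhysics.QuantumFieldTheory.Balaban1983to89.B8Eq142KLevelLocalGammaRec

end
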